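import Summits.AtomisticToContinuum.HydrodynamicLimit.Theorems.EnskogAdjointDualityCollisionResidualVanishesResidualAssembly
import Summits.AtomisticToContinuum.HydrodynamicLimit.Theorems.EnskogAdjointDualityCollisionResidualVanishesHydroAtTime
import Summits.AtomisticToContinuum.HydrodynamicLimit.Theorems.EnskogAdjointDualityDualityReductionInitial
import Summits.AtomisticToContinuum.HydrodynamicLimit.Theorems.EnskogAdjointDualityDualityReductionLBound
import Summits.AtomisticToContinuum.HydrodynamicLimit.Theorems.EnskogAdjointDualityDualityReductionLMeasurable
import Summits.AtomisticToContinuum.HydrodynamicLimit.Theorems.EnskogAdjointDualityDualityReductionFSide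
import Summits.AtomisticToContinuum.HydrodynamicLimit.Theorems.EnskogAdjointDualityDualityReductionProfiles
import Summits.AtomisticToContinuum.HydrodynamicLimit.Theorems.EnskogAdjointDualityDualityReductionCZero
import HarnessLib

/-!
# EnskogAdjointDuality / CollisionResidualVanishes — the converse duality theorem

Support theorem for the crux `Summit.AtomisticToContinuum.HydrodynamicLimit.Theses.EnskogAdjointDuality.CollisionResidualVanishes`
(K1, stmt-AtomisticToContinuum-14658, line `birth`). The route's deciding theorem uses K1 only on the
approximately-dual backward families of `AdjointEnskogTestFamilyR` (K2R), through the exact pathwise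
identity `A_t − B_t = (A_0 − B_0) + ∫⟨μ_s − f_s, (D+L)φ⟩ − … + 𝓡_N − Res_N` read from right to left
(`smooth_core`: K1 ∧ K2R ⇒ mean-square hydrodynamic limit). This file reads it from LEFT TO RIGHT:
for every admissible family with K2R's properties (i)–(v) at `(t, χ, a, b, e)`, convergence in
probability of the three empirical fields AT TIME `t` — the conclusion of the conjunct
`HydrodynamicLimit` along the given classical solution — implies `∫⁻ 𝓡_N[φ^N]² d(localGibbsLaw) → 0`,
i.e. K1's conclusion at that family (the `let`s `G ε lam f Y φ L R` verbatim those of the route decl).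

Consequence for the line `birth` (recorded for the route audit): restricted to the families the
assembly uses, K1 — and hence its stub `MeanDefectVanishes` — is EQUIVALENT to the mean-square
hydrodynamic limit at time `t`; the crux carries exactly the content of the conjunct there, so no
proof of K1 on those families can be easier than the conjunct itself, and conversely any proof of
the conjunct discharges K1 on them.

* `collisionResidual_tendsto_zero_of_tendstoHydroFieldsAt` — the statement above.

References: M. Pulvirenti, S. Simonella, arXiv:1504.03215, §2 [PulvirentiSimonella2016];
T. Bodineau, I. Gallagher, L. Saint-Raymond, Ann. PDE 3 (2017) [BGSR2017]; H. Spohn (1991),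
Part I Ch. 3 [Spohn1991].
-/

noncomputable section

open MeasureTheory Set Filter Topology Function
open scoped ENNReal BigOperators InnerProductSpace

namespace Summit.AtomisticToContinuum.HydrodynamicLimit.Theorems

open Literature.Analysis.FluidPDE Literature.MathematicalPhysics.KineticTheory
  Literature.Analysis.FunctionSpaces
open Literature.MathematicalPhysics.QuantumLattice (clamp_mem_Icc clamp_eq_self)

variable {a₀ θ₀ : T3 → ℝ} {u₀ : T3 → V3}

/-- **Converse duality: the hydrodynamic limit at time `t` implies that the collision residual
vanishes on every approximately-dual test family.** Fix an EOS window `(0, η₁)` on which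
`f_ex = hsExcessFreeEnergy` is analytic, continuous positive profiles, `0 < σ ≤ 1/2`, a classical
hs-Euler solution `(ρ, u, θ)` on `[0, T)` whose local Gibbs data satisfy the `t = 0` law of large
numbers, hard-sphere flows `Φ N`, a time `t ∈ (0, T)` with packing `ρ_sσ³ < η₁` on `[0, t]`, and an
ADMISSIBLE test family `φ^N = c^N·(1, v, |v|²/2) + κ^N/λ_N` with the properties (i)–(v) of the crux
`AdjointEnskogTestFamilyR` at `(t, χ, a, b, e)` (terminal data `χ(a + b·v + e|v|²/2)`; `C¹` along
free flight and defect `|Dφ^N + L^Nφ^N| ≤ η_N(1+|v|²)` on `[0,t]` eventually, `η_N → 0`;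
`c^N(0,·) → c₀` uniformly; Enskog defect `Res_N → 0`). IF the three empirical fields at time `t`
converge in probability to `(ρ, ρu, E)(t)` (`TendstoHydroFieldsAt … t` — the conclusion of the
conjunct `HydrodynamicLimit` at `t`), THEN the collision residual of the crux
`CollisionResidualVanishes` at this family tends to `0` in mean square:
`∫⁻ 𝓡_N[φ^N]² d(localGibbsLaw) → 0` (the `let`s `G ε lam f Y φ L R` are verbatim those of the route
decl). With the forward glue (`duality_assembly` / the route's `closes`) this says: on the
approximately-dual families the assembly uses, K1 is EQUIVALENT to the mean-square hydrodynamic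
limit at time `t`; in particular the conjunct itself implies K1 there.
[cite: PulvirentiSimonella2016, §2] -/
theorem collisionResidual_tendsto_zero_of_tendstoHydroFieldsAt {η₁ : ℝ}
    (hA : AnalyticOnNhd ℝ hsExcessFreeEnergy (Set.Ioo 0 η₁))
    (ha : Continuous a₀) (hθ : Continuous θ₀) (hu : Continuous u₀)
    (ha0 : ∀ x, 0 < a₀ x) (hθ0 : ∀ x, 0 < θ₀ x) {σ : ℝ} (hσ : 0 < σ) (hσhalf : σ ≤ 1 / 2)
    {T : ℝ} {ρ θ : ℝ → UnitAddTorus (Fin 3) → ℝ} {u : ℝ → UnitAddTorus (Fin 3) → EuclideanSpace ℝ (Fin 3)}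
    (hEul : IsHardSphereEulerSolution σ T ρ u θ)
    (Φ : (N : ℕ) → HardSphereFlow (Torus.geometry (Fin 3)) (hsDiameter σ N) (N + 1))
    (hLLN : TendstoHydroFieldsAt (fun N => localGibbsLaw σ a₀ u₀ θ₀ N (Φ N)) Φ ρ u θ 0)
    {t : ℝ} (ht : t ∈ Set.Ioo 0 T) (hguard : ∀ s ∈ Set.Icc 0 t, ∀ x, ρ s x * σ ^ 3 < η₁)
    (hHyd : TendstoHydroFieldsAt (fun N => localGibbsLaw σ a₀ u₀ θ₀ N (Φ N)) Φ ρ u θ t)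
    {χ : UnitAddTorus (Fin 3) → ℝ} (hχ : Continuous χ) (a e : ℝ) (b : EuclideanSpace ℝ (Fin 3))
    (c : ℕ → ℝ → UnitAddTorus (Fin 3) → ℝ × EuclideanSpace ℝ (Fin 3) × ℝ)
    (κ : ℕ → ℝ → UnitAddTorus (Fin 3) → EuclideanSpace ℝ (Fin 3) → ℝ)
    (hc : ∀ N, Continuous (Function.uncurry (c N)))
    (hκ : ∀ N, Continuous (fun p : ℝ × UnitAddTorus (Fin 3) × EuclideanSpace ℝ (Fin 3) =>
      κ N p.1 p.2.1 p.2.2))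
    (hadm : ∃ C : ℝ, ∀ N s x x' v v', ‖c N s x‖ ≤ C ∧ dist (c N s x) (c N s x') ≤ C * dist x x' ∧
      |κ N s x v| ≤ C * (1 + ‖v‖ ^ 2) ∧
      |κ N s x v - κ N s x' v'| ≤ C * (1 + ‖v‖ ^ 2 + ‖v'‖ ^ 2) * (dist x x' + ‖v - v'‖)) :
    let G := Literature.Analysis.FluidPDE.Torus.geometry (Fin 3)
    let ε := fun N : ℕ => Literature.MathematicalPhysics.KineticTheory.hsDiameter σ N
    let lam := fun N : ℕ => (N : ℝ) * ε N ^ 2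
    let f := fun (s : ℝ) (x : UnitAddTorus (Fin 3)) (v : EuclideanSpace ℝ (Fin 3)) =>
      ρ s x * Literature.Analysis.FluidPDE.localMaxwellian 1 (θ s x) (u s x) v
    let Y := fun η : ℝ => 3 / (2 * Real.pi) * deriv Literature.MathematicalPhysics.KineticTheory.hsExcessFreeEnergy η
    let φ := fun (N : ℕ) (s : ℝ) (x : UnitAddTorus (Fin 3)) (v : EuclideanSpace ℝ (Fin 3)) =>
      (c N s x).1 + inner ℝ (c N s x).2.1 v + (c N s x).2.2 * ‖v‖ ^ 2 / 2 + (lam N)⁻¹ * κ N s x v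
    let L := fun (N : ℕ) (s : ℝ) (x : UnitAddTorus (Fin 3)) (v : EuclideanSpace ℝ (Fin 3)) =>
      lam N * ∫ ω : Metric.sphere (0 : EuclideanSpace ℝ (Fin 3)) 1,
        (let y := G.translate x (ε N • (ω : EuclideanSpace ℝ (Fin 3)));
          ∫ w : EuclideanSpace ℝ (Fin 3), max (inner ℝ (v - w) ω) 0 *
            Y (σ ^ 3 * ρ s (G.translate x ((ε N / 2) • (ω : EuclideanSpace ℝ (Fin 3))))) * f s y w *
            (φ N s x (v - inner ℝ (v - w) ω • (ω : EuclideanSpace ℝ (Fin 3))) +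
              φ N s y (w + inner ℝ (v - w) ω • (ω : EuclideanSpace ℝ (Fin 3))) - φ N s x v - φ N s y w))
        ∂Literature.MathematicalPhysics.KineticTheory.sphereMeasure
    let R := fun (N : ℕ) (z : Literature.Analysis.FluidPDE.Config (N + 1) (Fin 3) (UnitAddTorus (Fin 3))) =>
      (let q := fun r : ℝ => (Φ N).flow r z;
        (N + 1 : ℝ)⁻¹ * (∑ᶠ (s : ℝ) (_ : s ∈ Literature.Analysis.FluidPDE.collisionTimes G (ε N) q ∩ Set.Ioc 0 t),
          ∑ i, ∑ j, (if i ≠ j ∧ ‖G.sepVec (q s i).1 (q s j).1‖ = ε N then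
            φ N s (q s i).1 (q s i).2 -
              φ N s (q s i).1 (Literature.Analysis.FluidPDE.reflectVel (G.sepVec (q s i).1 (q s j).1)
                ((q s i).2, (q s j).2)).1 else 0)) -
        (∫ s in Set.Icc 0 t, ∫ y, L N s y.1 y.2 ∂(Literature.Analysis.FluidPDE.empiricalMeasure (q s))) +
        (1 / 2 : ℝ) * ∫ s in Set.Icc 0 t, ∫ x : UnitAddTorus (Fin 3), ∫ v : EuclideanSpace ℝ (Fin 3),
          f s x v * L N s x v)
    (∀ N x v, φ N t x v = χ x * (a + inner ℝ b v + e * ‖v‖ ^ 2 / 2)) →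
    (∃ η : ℕ → ℝ, Filter.Tendsto η Filter.atTop (nhds 0) ∧ ∀ᶠ N in Filter.atTop,
      (∀ x v, ContDiffOn ℝ 1 (fun r => φ N r (G.translate x (r • v)) v) (Set.Icc 0 t)) ∧
      (∀ s ∈ Set.Icc 0 t, ∀ x v, |derivWithin (fun r => φ N r (G.translate x ((r - s) • v)) v)
        (Set.Icc 0 t) s + L N s x v| ≤ η N * (1 + ‖v‖ ^ 2))) →
    (∃ c₀ : UnitAddTorus (Fin 3) → ℝ × EuclideanSpace ℝ (Fin 3) × ℝ, Continuous c₀ ∧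
      ∀ δ : ℝ, 0 < δ → ∀ᶠ N in Filter.atTop, ∀ x, dist (c N 0 x) (c₀ x) ≤ δ) →
    Filter.Tendsto (fun N : ℕ => (∫ x : UnitAddTorus (Fin 3), ∫ v : EuclideanSpace ℝ (Fin 3),
        f t x v * φ N t x v) -
      (∫ x : UnitAddTorus (Fin 3), ∫ v : EuclideanSpace ℝ (Fin 3), f 0 x v * φ N 0 x v) -
      ∫ s in Set.Icc 0 t, ∫ x : UnitAddTorus (Fin 3), ∫ v : EuclideanSpace ℝ (Fin 3), f s x v *
        (derivWithin (fun r => φ N r (G.translate x ((r - s) • v)) v) (Set.Icc 0 t) s +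
          (1 / 2 : ℝ) * L N s x v)) Filter.atTop (nhds 0) →
    Filter.Tendsto (fun N : ℕ => ∫⁻ z, ENNReal.ofReal (R N z ^ 2)
      ∂(Literature.MathematicalPhysics.KineticTheory.localGibbsLaw σ a₀ u₀ θ₀ N (Φ N)))
      Filter.atTop (nhds 0) := by
  intro G₀ ε₀ lam f Y φ L R hterm hreg hc0 hResT
  obtain ⟨C, hadm⟩ := hadm
  obtain ⟨η, hη, hev⟩ := hreg
  obtain ⟨c₀, hc₀, hconv⟩ := hc0
  -- profiles on the window
  obtain ⟨hρc, huc, hθc, Rb, U, Θ, hρb, hub, hθb⟩ := eulerProfiles_window hEul ht.2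
  have hρb' : ∀ s ∈ Icc 0 t, ∀ x, 0 ≤ ρ s x ∧ ρ s x ≤ Rb := fun s hs x =>
    ⟨(hρb s hs x).1.le, (hρb s hs x).2⟩
  obtain ⟨hYc, Ybar, hYb⟩ := contactValue_window (t := t) hσ hA hρc (fun s hs x => (hρb s hs x).1) hguard
  obtain ⟨CG, hCG0, hCG⟩ := exists_integral_one_add_norm_sq_sq_gaussMeasure_le U Θ
  -- continuity and growth of the test functions
  have hφc : ∀ N, Continuous fun p : ℝ × T3 × V3 => φ N p.1 p.2.1 p.2.2 := by
    intro N
    have hcN : Continuous fun p : ℝ × T3 × V3 => c N p.1 p.2.1 :=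
      (hc N).comp (continuous_fst.prodMk continuous_snd.fst)
    have h1c : Continuous fun p : ℝ × T3 × V3 => (c N p.1 p.2.1).1 := continuous_fst.comp hcN
    have h21 : Continuous fun p : ℝ × T3 × V3 => (c N p.1 p.2.1).2.1 :=
      continuous_fst.comp (continuous_snd.comp hcN)
    have h22 : Continuous fun p : ℝ × T3 × V3 => (c N p.1 p.2.1).2.2 :=
      continuous_snd.comp (continuous_snd.comp hcN)
    show Continuous fun p : ℝ × T3 × V3 => (c N p.1 p.2.1).1 + ⟪(c N p.1 p.2.1).2.1, p.2.2⟫_ℝ +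
      (c N p.1 p.2.1).2.2 * ‖p.2.2‖ ^ 2 / 2 + (lam N)⁻¹ * κ N p.1 p.2.1 p.2.2
    exact ((h1c.add (h21.inner continuous_snd.snd)).add
      ((h22.mul (continuous_snd.snd.norm.pow 2)).div_const 2)).add (continuous_const.mul (hκ N))
  have hφb : ∀ N s x v, |φ N s x v| ≤ (3 * C + |(lam N)⁻¹| * C) * (1 + ‖v‖ ^ 2) := fun N s x v =>
    abs_testFn_le v (hadm N s x x v v).1 (hadm N s x x v v).2.2.1
  -- the test-side operator: growth and measurability, per `N`
  have hπc : Continuous fun s : ℝ => max 0 (min t s) :=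
    continuous_const.max (continuous_const.min continuous_id)
  have hLfacts : ∀ N, ∃ K : ℝ, (∀ s ∈ Icc 0 t, ∀ x v, |L N s x v| ≤ K * (1 + ‖v‖ ^ 2) ^ 2) ∧
      Measurable fun p : ℝ × T3 × V3 => L N (max 0 (min t p.1)) p.2.1 p.2.2 := by
    intro N
    obtain ⟨K, -, hK⟩ := abs_enskogL_le (t := t)
      (Yf := fun s x' => 3 / (2 * Real.pi) * deriv hsExcessFreeEnergy (σ ^ 3 * ρ s x'))
      (g := ρ) (θf := θ) (uf := u) (φ := φ N)
      (xs := fun x ω => G₀.translate x ((ε₀ N / 2) • (ω : V3)))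
      (ys := fun x ω => G₀.translate x (ε₀ N • (ω : V3)))
      (Ybar := Ybar) (R := Rb) (U := U) (Θ := Θ) (Cφ := 3 * C + |(lam N)⁻¹| * C) (lam := lam N)
      hYb hρb' hub hθb (fun s _ x v => hφb N s x v) (L N) (fun s x v => rfl)
    refine ⟨K, hK, ?_⟩
    have hsm1 : Continuous fun p : T3 × Metric.sphere (0 : V3) 1 => (ε₀ N / 2) • (p.2 : V3) := by
      fun_prop
    have hsm2 : Continuous fun p : T3 × Metric.sphere (0 : V3) 1 => ε₀ N • (p.2 : V3) := by
      fun_prop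
    have hxs : Continuous (uncurry fun (x : T3) (ω : Metric.sphere (0 : V3) 1) =>
        G₀.translate x ((ε₀ N / 2) • (ω : V3))) := by
      show Continuous fun p : T3 × Metric.sphere (0 : V3) 1 => p.1 + Torus.proj ((ε₀ N / 2) • (p.2 : V3))
      exact continuous_fst.add (Torus.continuous_proj.comp hsm1)
    have hys : Continuous (uncurry fun (x : T3) (ω : Metric.sphere (0 : V3) 1) =>
        G₀.translate x (ε₀ N • (ω : V3))) := by
      show Continuous fun p : T3 × Metric.sphere (0 : V3) 1 => p.1 + Torus.proj (ε₀ N • (p.2 : V3))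
      exact continuous_fst.add (Torus.continuous_proj.comp hsm2)
    exact measurable_enskogL_of_continuous
      (Yf := fun s x' => 3 / (2 * Real.pi) * deriv hsExcessFreeEnergy (σ ^ 3 * ρ (max 0 (min t s)) x'))
      (g := fun s => ρ (max 0 (min t s))) (θf := fun s => θ (max 0 (min t s)))
      (uf := fun s => u (max 0 (min t s))) (φ := fun s => φ N (max 0 (min t s)))
      (xs := fun x ω => G₀.translate x ((ε₀ N / 2) • (ω : V3)))
      (ys := fun x ω => G₀.translate x (ε₀ N • (ω : V3))) (lam := lam N)
      (continuous_frozen (g := fun s x' => 3 / (2 * Real.pi) * deriv hsExcessFreeEnergy (σ ^ 3 * ρ s x'))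
        ht.1.le hYc) (continuous_frozen ht.1.le hρc) (continuous_frozen ht.1.le hθc)
      (fun s x => (hθb _ (clamp_mem_Icc ht.1.le s) x).1) (continuous_frozen ht.1.le huc)
      ((hφc N).comp ((hπc.comp continuous_fst).prodMk continuous_snd)) hxs hys
      (fun s => L N (max 0 (min t s))) (fun s x v => rfl)
  -- the frozen Maxwellian weight is measurable
  have hfrozc : Continuous fun p : ℝ × T3 × V3 => f (max 0 (min t p.1)) p.2.1 p.2.2 := by
    have hq : Continuous fun p : ℝ × T3 × V3 => ((p.1, p.2.1) : ℝ × T3) :=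
      continuous_fst.prodMk continuous_snd.fst
    have hρf := (continuous_frozen ht.1.le hρc).comp hq
    have hθf := (continuous_frozen ht.1.le hθc).comp hq
    have huf := (continuous_frozen ht.1.le huc).comp hq
    show Continuous fun p : ℝ × T3 × V3 => ρ (max 0 (min t p.1)) p.2.1 *
      localMaxwellian 1 (θ (max 0 (min t p.1)) p.2.1) (u (max 0 (min t p.1)) p.2.1) p.2.2
    exact hρf.mul (continuous_localMaxwellian_param hθf
      (fun p => (hθb _ (clamp_mem_Icc ht.1.le p.1) p.2.1).1) huf continuous_snd.snd)
  -- the Euler side: `I₃ + ½ I₂ → 0`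
  have hFbound : ∀ᶠ N in atTop, |(∫ s in Icc 0 t, ∫ x, ∫ v, f s x v *
        (derivWithin (fun r => φ N r ((Torus.geometry (Fin 3)).translate x ((r - s) • v)) v)
          (Icc 0 t) s + (1 / 2 : ℝ) * L N s x v)) +
      (1 / 2 : ℝ) * ∫ s in Icc 0 t, ∫ x, ∫ v, f s x v * L N s x v| ≤ η N * (t * (Rb * CG)) := by
    filter_upwards [hev] with N hN
    obtain ⟨-, hdef⟩ := hN
    obtain ⟨K, hKb, hKm⟩ := hLfacts N
    have hη0 : 0 ≤ η N := by
      have h := (abs_nonneg _).trans (hdef 0 ⟨le_rfl, ht.1.le⟩ 0 0)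
      simpa using h
    exact abs_I3_add_half_I2_le ht.1 hρb' hub hθb hCG (f := f) (fun s x v => rfl)
      (Φf := fun p => f (max 0 (min t p.1)) p.2.1 p.2.2) hfrozc.measurable
      (fun s hs x v => by simp only [clamp_eq_self hs])
      (fun s x v => derivWithin (fun r => φ N r ((Torus.geometry (Fin 3)).translate x ((r - s) • v)) v)
        (Icc 0 t) s) (L N)
      (Dm := fun p => deriv (fun r => φ N r ((Torus.geometry (Fin 3)).translate p.2.1
        ((r - p.1) • p.2.2)) p.2.2) p.1)
      (Lm := fun p => L N (max 0 (min t p.1)) p.2.1 p.2.2) (measurable_charDeriv (hφc N)) hKm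
      (fun s hs x v => derivWithin_charDeriv_eq_deriv hs x v)
      (fun s hs x v => by simp only [clamp_eq_self hs]) hKb hη0 hdef
  have hF : Tendsto (fun N => (∫ s in Icc 0 t, ∫ x, ∫ v, f s x v *
        (derivWithin (fun r => φ N r ((Torus.geometry (Fin 3)).translate x ((r - s) • v)) v)
          (Icc 0 t) s + (1 / 2 : ℝ) * L N s x v)) +
      (1 / 2 : ℝ) * ∫ s in Icc 0 t, ∫ x, ∫ v, f s x v * L N s x v) atTop (𝓝 0) := by
    refine squeeze_zero_norm' (a := fun N => η N * (t * (Rb * CG))) (hFbound.mono fun N h => ?_) ?_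
    · rw [Real.norm_eq_abs]; exact h
    · simpa using hη.mul_const (t * (Rb * CG))
  -- the initial term
  have hlamInv : Tendsto (fun N => (lam N)⁻¹) atTop (𝓝 0) := by
    show Tendsto (fun N : ℕ => ((N : ℝ) * hsDiameter σ N ^ 2)⁻¹) atTop (𝓝 0)
    exact tendsto_lamInv_zero hσ
  have h0mem : (0 : ℝ) ∈ Icc 0 t := ⟨le_rfl, ht.1.le⟩
  have hρ0c : Continuous (ρ 0) :=
    hρc.comp_continuous (continuous_const.prodMk continuous_id) fun x => ⟨h0mem, mem_univ x⟩
  have hu0c : Continuous (u 0) :=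
    huc.comp_continuous (continuous_const.prodMk continuous_id) fun x => ⟨h0mem, mem_univ x⟩
  have hθ0c : Continuous (θ 0) :=
    hθc.comp_continuous (continuous_const.prodMk continuous_id) fun x => ⟨h0mem, mem_univ x⟩
  have h0 := initial_term_tendsto ha hθ hu ha0 hθ0 hσhalf Φ hLLN hρ0c hu0c hθ0c
    (fun x => (hθb 0 h0mem x).1) (fun x => (hρb 0 h0mem x).1.le) c κ hc hκ (C := C)
    (fun N s x v => ⟨(hadm N s x x v v).1, (hadm N s x x v v).2.2.1⟩) (fun N => (lam N)⁻¹) hlamInv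
    hc₀ hconv φ (fun N s x v => rfl) f (fun s x v => rfl)
  -- the time-`t` term: the hydrodynamic limit at time `t`, made `L²` and identified
  have htmem : t ∈ Icc 0 t := ⟨ht.1.le, le_rfl⟩
  have hρtc : Continuous (ρ t) :=
    hρc.comp_continuous (continuous_const.prodMk continuous_id) fun x => ⟨htmem, mem_univ x⟩
  have hutc : Continuous (u t) :=
    huc.comp_continuous (continuous_const.prodMk continuous_id) fun x => ⟨htmem, mem_univ x⟩
  have hθtc : Continuous (θ t) :=
    hθc.comp_continuous (continuous_const.prodMk continuous_id) fun x => ⟨htmem, mem_univ x⟩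
  have hcombo := tendsto_lintegral_sq_hydroCombo_of_tendstoHydroFieldsAt ha hθ hu ha0 hθ0 hσhalf Φ
    hHyd hχ a e b
  have hAeq : ∀ N (w : Config (N + 1) (Fin 3) T3),
      ((N : ℝ) + 1)⁻¹ * (∑ i, φ N t (w i).1 (w i).2) =
        a * empiricalDensityField w χ + ⟪b, empiricalMomentumField w χ⟫_ℝ +
          e * empiricalEnergyField w χ := by
    intro N w
    rw [← avg_chi_affine_eq_combo w χ a e b]
    congr 1
    exact Finset.sum_congr rfl fun i _ => hterm N _ _
  have hBeq : ∀ N, (∫ x, ∫ v, f t x v * φ N t x v) =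
      a * (∫ x, χ x * ρ t x) + ⟪b, ∫ x, (χ x * ρ t x) • u t x⟫_ℝ +
        e * ∫ x, χ x * totalEnergyDensity (ρ t x) (u t x) (θ t x) := by
    intro N
    rw [← integral_ft_chi_affine_eq_combo hρtc hutc hθtc (fun x => (hθb t htmem x).1) hχ a e b]
    refine integral_congr_ae (Eventually.of_forall fun x => integral_congr_ae
      (Eventually.of_forall fun v => ?_))
    show f t x v * φ N t x v = _
    rw [hterm]
  have hAt : Tendsto (fun N => ∫⁻ z, ENNReal.ofReal
      ((((N : ℝ) + 1)⁻¹ * (∑ i, φ N t ((Φ N).flow t z i).1 ((Φ N).flow t z i).2) -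
        ∫ x, ∫ v, f t x v * φ N t x v) ^ 2)
      ∂localGibbsLaw σ a₀ u₀ θ₀ N (Φ N)) atTop (𝓝 0) := by
    refine hcombo.congr fun N => lintegral_congr fun z => ?_
    have hid : a * (empiricalDensityField ((Φ N).flow t z) χ - ∫ x, χ x * ρ t x) +
        ⟪b, empiricalMomentumField ((Φ N).flow t z) χ - ∫ x, (χ x * ρ t x) • u t x⟫_ℝ +
        e * (empiricalEnergyField ((Φ N).flow t z) χ -
          ∫ x, χ x * totalEnergyDensity (ρ t x) (u t x) (θ t x)) =
        ((N : ℝ) + 1)⁻¹ * (∑ i, φ N t ((Φ N).flow t z i).1 ((Φ N).flow t z i).2) -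
          ∫ x, ∫ v, f t x v * φ N t x v := by
      rw [hAeq N ((Φ N).flow t z), hBeq N, inner_sub_right]
      ring
    rw [hid]
  -- the assembly, read from left to right
  exact residual_assembly ha hθ hu ha0 hθ0 hσhalf Φ ht.1 φ L f R hφc ⟨η, hη, hev⟩ hLfacts
    (fun N z => rfl) hAt hResT hF h0

/-- **Registered form** (sub-goal `converse_duality` of the crux stmt-AtomisticToContinuum-14658, line `birth`): `collisionResidual_tendsto_zero_of_tendstoHydroFieldsAt` as a closed `∀`-statement — the hydrodynamic limit at time `t` implies the collision residual of K1 vanishes in mean square on every approximately-dual admissible family. [cite: PulvirentiSimonella2016, §2] -/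
theorem converse_duality : ∀ {a₀ θ₀ : T3 → ℝ} {u₀ : T3 → V3} {η₁ : ℝ} (hA : AnalyticOnNhd ℝ hsExcessFreeEnergy (Ioo 0 η₁)) (ha : Continuous a₀) (hθ : Continuous θ₀) (hu : Continuous u₀) (ha0 : ∀ x, 0 < a₀ x) (hθ0 : ∀ x, 0 < θ₀ x) {σ : ℝ} (hσ : 0 < σ) (hσhalf : σ ≤ 1 / 2) {T : ℝ} {ρ θ : ℝ → T3 → ℝ} {u : ℝ → T3 → V3} (hEul : IsHardSphereEulerSolution σ T ρ u θ) (Φ : (N : ℕ) → HardSphereFlow (Torus.geometry (Fin 3)) (hsDiameter σ N) (N + 1)) (hLLN : TendstoHydroFieldsAt (fun N => localGibbsLaw σ a₀ u₀ θ₀ N (Φ N)) Φ ρ u θ 0) {t : ℝ} (ht : t ∈ Ioo 0 T) (hguard : ∀ s ∈ Icc 0 t, ∀ x, ρ s x * σ ^ 3 < η₁) (hHyd : TendstoHydroFieldsAt (fun N => localGibbsLaw σ a₀ u₀ θ₀ N (Φ N)) Φ ρ u θ t) {χ : T3 → ℝ} (hχ : Continuous χ) (a e : ℝ) (b : V3)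 (c : ℕ → ℝ → T3 → ℝ × V3 × ℝ) (κ : ℕ → ℝ → T3 → V3 → ℝ) (hc : ∀ N, Continuous (uncurry (c N))) (hκ : ∀ N, Continuous (fun p : ℝ × T3 × V3 => κ N p.1 p.2.1 p.2.2)) (hadm : ∃ C : ℝ, ∀ N s x x' v v', ‖c N s x‖ ≤ C ∧ dist (c N s x) (c N s x') ≤ C * dist x x' ∧ |κ N s x v| ≤ C * (1 + ‖v‖ ^ 2) ∧ |κ N s x v - κ N s x' v'| ≤ C * (1 + ‖v‖ ^ 2 + ‖v'‖ ^ 2) * (dist x x' + ‖v - v'‖)), let G := Torus.geometry (Fin 3); let ε := fun N : ℕ => hsDiameter σ N; let lam := fun N : ℕ => (N : ℝ) * ε N ^ 2; let f := fun (s : ℝ) (x : T3) (v : V3) => ρ s x * localMaxwellian 1 (θ s x) (u s x) v; let Y := fun η : ℝ => 3 / (2 * Real.pi) * deriv hsExcessFreeEnergy η; let φ := fun (N : ℕ) (s : ℝ) (x : T3) (v : V3) => (c N s x).1 + inner ℝ (c N s x).2.1 v + (c N s x).2.2 * ‖v‖ ^ 2 / 2 + (lam N)⁻¹ * κ N s x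 v; let L := fun (N : ℕ) (s : ℝ) (x : T3) (v : V3) => lam N * ∫ ω : Metric.sphere (0 : V3) 1, (let y := G.translate x (ε N • (ω : V3)); ∫ w : V3, max (inner ℝ (v - w) ω) 0 * Y (σ ^ 3 * ρ s (G.translate x ((ε N / 2) • (ω : V3)))) * f s y w * (φ N s x (v - inner ℝ (v - w) ω • (ω : V3)) + φ N s y (w + inner ℝ (v - w) ω • (ω : V3)) - φ N s x v - φ N s y w)) ∂sphereMeasure; let R := fun (N : ℕ) (z : Config (N + 1) (Fin 3) (T3)) => (let q := fun r : ℝ => (Φ N).flow r z; (N + 1 : ℝ)⁻¹ * (∑ᶠ (s : ℝ) (_ : s ∈ collisionTimes G (ε N) q ∩ Ioc 0 t), ∑ i, ∑ j, (if i ≠ j ∧ ‖G.sepVec (q s i).1 (q s j).1‖ = ε N then φ N s (q s i).1 (q s i).2 - φ N s (q s i).1 (reflectVel (G.sepVec (q s i).1 (q s j).1) ((q s i).2, (q s j).2)).1 else 0)) - (∫ s in Icc 0 t, ∫ y, L N s y.1 y.2 ∂(empiricalMeasure (q s))) + (1 / 2 : ℝ) * ∫ s in Icc 0 t, ∫ x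 : T3, ∫ v : V3, f s x v * L N s x v); (∀ N x v, φ N t x v = χ x * (a + inner ℝ b v + e * ‖v‖ ^ 2 / 2)) → (∃ η : ℕ → ℝ, Tendsto η atTop (𝓝 0) ∧ ∀ᶠ N in atTop, (∀ x v, ContDiffOn ℝ 1 (fun r => φ N r (G.translate x (r • v)) v) (Icc 0 t)) ∧ (∀ s ∈ Icc 0 t, ∀ x v, |derivWithin (fun r => φ N r (G.translate x ((r - s) • v)) v) (Icc 0 t) s + L N s x v| ≤ η N * (1 + ‖v‖ ^ 2))) → (∃ c₀ : T3 → ℝ × V3 × ℝ, Continuous c₀ ∧ ∀ δ : ℝ, 0 < δ → ∀ᶠ N in atTop, ∀ x, dist (c N 0 x) (c₀ x) ≤ δ) → Tendsto (fun N : ℕ => (∫ x : T3, ∫ v : V3, f t x v * φ N t x v) - (∫ x : T3, ∫ v : V3, f 0 x v * φ N 0 x v) - ∫ s in Icc 0 t, ∫ x : T3, ∫ v : V3, f s x v * (derivWithin (fun r => φ N r (G.translate x ((r - s) • v)) v) (Icc 0 t) s + (1 / 2 : ℝ) * L N s x v)) atTop (𝓝 0) → Tendsto (fun N : ℕ =>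 ∫⁻ z, ENNReal.ofReal (R N z ^ 2) ∂(localGibbsLaw σ a₀ u₀ θ₀ N (Φ N))) atTop (𝓝 0) :=
  @collisionResidual_tendsto_zero_of_tendstoHydroFieldsAt

end Summit.AtomisticToContinuum.HydrodynamicLimit.Theorems

end
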